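import Literature.NumberTheory.EllipticCurves.EisensteinWeightOneFullRowDuplication
import Literature.NumberTheory.EllipticCurves.Gamma0EisensteinWeightOneContinuation
import Mathlib.Analysis.Complex.LocallyUniformLimit
import HarnessLib

/-!
# The continuation of the full lattice row of the weight-one Eisenstein series to `Re s > -1/2`

Topic `Literature/NumberTheory/EllipticCurves`; namespace
`Literature.NumberTheory.EllipticCurves.ModularForms`. One definition with a body (`fullRowCont`)
and theorems; no named fact.

By `EisensteinWeightOneFullRowDuplication.lean`, for `Im w > 0` and `Re s > 0` the full row
`R₀(w, s) = ∑_{d ∈ ℤ} (d+w)^{-1-s}(d+w̄)^{-s}` equals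

  `R̃₀(w, s) = -i I₂(s) (Im w)^{-2s} + ∑_{j ≥ 0} (2^{j+1})^{2s} R̃(χ_alt, 2^{j+1} w, s)`   (`fullRowCont`)

with the Abel-continued alternating rows `R̃(χ_alt, ·, s)` (`rowCont 2 altWeight`) and the
constant-term integral `I₂(s) = ∫_ℝ (1+u²)^{-1-s} du`. We prove that `R̃₀` is the analytic
continuation of the full row:

* `fullRow_eq_fullRowCont` — `R₀ = R̃₀` on `Re s > 0`;
* `norm_scaled_rowCont_altWeight_le` — the `j`-th term is at most
  `160 (1+‖s‖)² e^{2π|Im s|} I(3+2σ) (Im w)^{-2-2σ} 4^{-(j+1)}` for `Re s > -1`, so the series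
  converges absolutely and locally uniformly there (`summable_scaled_rowCont_altWeight`);
* `differentiableOn_fullRowCont` — **`s ↦ R̃₀(w, s)` is holomorphic on `Re s > -1/2`**
  (the series on `Re s > -1` by dominated holomorphy on boxes, `I₂` on `Re s > -1/2` by
  `EisensteinWeightOneConstantIntegral.lean`);
* `norm_fullRowCont_le` — **the polynomial bound**
  `‖R̃₀(w, s)‖ ≤ I(2+2σ) (Im w)^{-2σ} + (160/3) (1+‖s‖)² e^{2π|Im s|} I(3+2σ) (Im w)^{-2-2σ}`
  for `Re s > -1/2` (`I(a) = ∫_ℝ (1+v²)^{-a/2} dv`), uniform on compacts in `s` — the growth in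
  `Im w → 0` and the decay in `Im w → ∞` of the continued full row that control Hecke's congruence
  Eisenstein series of weight one at every cusp (next files).

At `s = 0` the constant term is `-i I₂(0) = -iπ`, the constant of `π cot(πw) = -πi - 2πi ∑ qᵐ`
(Hecke 1927, §2; Schoeneberg VII §2).

## References

* E. Hecke, *Theorie der Eisensteinschen Reihen höherer Stufe…*, Abh. Math. Sem. Hamburg 5 (1927),
  §2.
* B. Schoeneberg, *Elliptic Modular Functions*, Springer (1974), Ch. VII §2.
-/

noncomputable section

open Complex Real Set MeasureTheory Filter Finset
open scoped Topology ComplexConjugate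

namespace Literature.NumberTheory.EllipticCurves.ModularForms

/-! ### The object -/

/-- **The continued full row**
`R̃₀(w, s) = -i I₂(s) (Im w)^{-2s} + ∑_{j ≥ 0} (2^{j+1})^{2s} R̃(χ_alt, 2^{j+1} w, s)`. [folklore] -/
def fullRowCont (w s : ℂ) : ℂ :=
  -I * constIntegral s * ((w.im : ℝ) : ℂ) ^ (-2 * s) +
    ∑' j : ℕ, ((2 ^ (j + 1) : ℕ) : ℂ) ^ (2 * s) *
      rowCont 2 altWeight (((2 ^ (j + 1) : ℕ) : ℂ) * w) s

/-! ### The series of scaled alternating rows on `Re s > -1` -/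

section Series

variable {w : ℂ} (hw : 0 < w.im)
include hw

/-- **The `j`-th term is at most `160 (1+‖s‖)² e^{2π|Im s|} I(3+2σ) (Im w)^{-2-2σ} 4^{-(j+1)}`**
for `Re s > -1`. [folklore] -/
theorem norm_scaled_rowCont_altWeight_le {s : ℂ} (hs : -1 < s.re) (j : ℕ) :
    ‖((2 ^ (j + 1) : ℕ) : ℂ) ^ (2 * s) * rowCont 2 altWeight (((2 ^ (j + 1) : ℕ) : ℂ) * w) s‖ ≤
      160 * (1 + ‖s‖) ^ 2 * Real.exp (2 * π * |s.im|) *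
        (∫ v : ℝ, (1 + v ^ 2) ^ (-(3 + 2 * s.re) / 2)) * w.im ^ (-2 - 2 * s.re) *
          (((2 : ℝ) ^ (j + 1)) ^ 2)⁻¹ := by
  have hη : 0 < w.im := hw
  set N : ℕ := 2 ^ (j + 1) with hN
  have hNpos : 0 < N := by rw [hN]; positivity
  have hNr : (0 : ℝ) < N := by exact_mod_cast hNpos
  have hW : 0 < (((N : ℂ)) * w).im := natCast_mul_im_pos hw hNpos
  have hWim : (((N : ℂ)) * w).im = N * w.im := natCast_mul_im N w
  rw [norm_mul, Complex.norm_natCast_cpow_of_pos hNpos]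
  simp only [Complex.mul_re, Complex.re_ofNat, Complex.im_ofNat, zero_mul, sub_zero]
  have h := norm_rowCont_altWeight_le hW hs
  rw [hWim] at h
  set D : ℝ := 160 * (1 + ‖s‖) ^ 2 * Real.exp (2 * π * |s.im|) *
    (∫ v : ℝ, (1 + v ^ 2) ^ (-(3 + 2 * s.re) / 2)) with hD
  have hNpow : ((N : ℝ)) ^ (2 * s.re) * ((N : ℝ) * w.im) ^ (-2 - 2 * s.re) =
      w.im ^ (-2 - 2 * s.re) * (((2 : ℝ) ^ (j + 1)) ^ 2)⁻¹ := by
    rw [Real.mul_rpow hNr.le hη.le, ← mul_assoc, ← Real.rpow_add hNr,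
      show 2 * s.re + (-2 - 2 * s.re) = -2 by ring, Real.rpow_neg hNr.le, Real.rpow_two, hN]
    push_cast
    ring
  calc ((N : ℝ)) ^ (2 * s.re) * ‖rowCont 2 altWeight ((N : ℂ) * w) s‖
      ≤ ((N : ℝ)) ^ (2 * s.re) * (D * ((N : ℝ) * w.im) ^ (-2 - 2 * s.re)) :=
        mul_le_mul_of_nonneg_left (by rw [hD]; exact h) (Real.rpow_nonneg hNr.le _)
    _ = D * w.im ^ (-2 - 2 * s.re) * (((2 : ℝ) ^ (j + 1)) ^ 2)⁻¹ := by
        rw [show ((N : ℝ)) ^ (2 * s.re) * (D * ((N : ℝ) * w.im) ^ (-2 - 2 * s.re)) =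
          D * (((N : ℝ)) ^ (2 * s.re) * ((N : ℝ) * w.im) ^ (-2 - 2 * s.re)) by ring, hNpow]
        ring

omit hw in
/-- `∑_{j ≥ 0} 4^{-(j+1)} = 1/3`, as a `HasSum` of `((2^{j+1})²)⁻¹`. [folklore] -/
theorem hasSum_inv_four_pow_succ :
    HasSum (fun j : ℕ ↦ (((2 : ℝ) ^ (j + 1)) ^ 2)⁻¹) (1 / 3) := by
  have h := (hasSum_geometric_of_lt_one (r := (4 : ℝ)⁻¹) (by norm_num) (by norm_num)).mul_left
    (4 : ℝ)⁻¹
  have e : ∀ j : ℕ, (4 : ℝ)⁻¹ * ((4 : ℝ)⁻¹) ^ j = (((2 : ℝ) ^ (j + 1)) ^ 2)⁻¹ := by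
    intro j
    rw [← pow_succ', ← pow_mul, mul_comm (j + 1) 2, pow_mul, inv_pow]
    norm_num
  simp_rw [e] at h
  rw [show (1 / 3 : ℝ) = 4⁻¹ * (1 - 4⁻¹)⁻¹ by norm_num]
  exact h

/-- Summability of the series for `Re s > -1`. [folklore] -/
theorem summable_scaled_rowCont_altWeight {s : ℂ} (hs : -1 < s.re) :
    Summable fun j : ℕ ↦ ((2 ^ (j + 1) : ℕ) : ℂ) ^ (2 * s) *
      rowCont 2 altWeight (((2 ^ (j + 1) : ℕ) : ℂ) * w) s :=
  Summable.of_norm_bounded (hasSum_inv_four_pow_succ.summable.mul_left _)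
    (fun j ↦ norm_scaled_rowCont_altWeight_le hw hs j)

/-- **The bound on the series**:
`‖∑_j (2^{j+1})^{2s} R̃(χ_alt, 2^{j+1}w, s)‖ ≤ (160/3)(1+‖s‖)² e^{2π|Im s|} I(3+2σ)(Im w)^{-2-2σ}`
(`Re s > -1`). [folklore] -/
theorem norm_tsum_scaled_rowCont_altWeight_le {s : ℂ} (hs : -1 < s.re) :
    ‖∑' j : ℕ, ((2 ^ (j + 1) : ℕ) : ℂ) ^ (2 * s) *
        rowCont 2 altWeight (((2 ^ (j + 1) : ℕ) : ℂ) * w) s‖ ≤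
      160 * (1 + ‖s‖) ^ 2 * Real.exp (2 * π * |s.im|) *
        (∫ v : ℝ, (1 + v ^ 2) ^ (-(3 + 2 * s.re) / 2)) * w.im ^ (-2 - 2 * s.re) * (1 / 3) := by
  have hg := hasSum_inv_four_pow_succ.mul_left (160 * (1 + ‖s‖) ^ 2 * Real.exp (2 * π * |s.im|) *
    (∫ v : ℝ, (1 + v ^ 2) ^ (-(3 + 2 * s.re) / 2)) * w.im ^ (-2 - 2 * s.re))
  rw [← hg.tsum_eq]
  exact tsum_of_norm_bounded hg.summable.hasSum (fun j ↦ norm_scaled_rowCont_altWeight_le hw hs j)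

/-- **`R₀ = R̃₀` on `Re s > 0`.** [folklore] -/
theorem fullRow_eq_fullRowCont {s : ℂ} (hs : 0 < s.re) : fullRow w s = fullRowCont w s := by
  rw [fullRow_eq_constant_add_tsum hw hs]
  unfold fullRowCont
  congr 1
  refine tsum_congr fun j ↦ ?_
  rw [altRow_eq_rowCont (natCast_mul_im_pos hw (by positivity)) hs]

/-! ### Holomorphy -/

/-- Each term is holomorphic on `Re s > -1`. [folklore] -/
theorem differentiableAt_scaled_rowCont_altWeight {s : ℂ} (hs : -1 < s.re) (j : ℕ) :
    DifferentiableAt ℂ (fun s : ℂ ↦ ((2 ^ (j + 1) : ℕ) : ℂ) ^ (2 * s) *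
      rowCont 2 altWeight (((2 ^ (j + 1) : ℕ) : ℂ) * w) s) s := by
  have hN : (((2 ^ (j + 1) : ℕ)) : ℂ) ≠ 0 := by exact_mod_cast pow_ne_zero (j + 1) two_ne_zero
  refine DifferentiableAt.mul ?_ ?_
  · exact (differentiableAt_id.const_mul (2 : ℂ)).const_cpow (Or.inl hN)
  · exact differentiableAt_rowCont (by norm_num) altWeight (natCast_mul_im_pos hw (by positivity)) hs

/-- **The series is holomorphic on boxes** `a < Re s < b`, `|Im s| < T` with `-1 < a`. [folklore] -/
theorem differentiableOn_tsum_scaled_rowCont_box {a b T : ℝ} (ha : -1 < a) (hT : 0 < T) :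
    DifferentiableOn ℂ (fun s : ℂ ↦ ∑' j : ℕ, ((2 ^ (j + 1) : ℕ) : ℂ) ^ (2 * s) *
      rowCont 2 altWeight (((2 ^ (j + 1) : ℕ) : ℂ) * w) s)
      {s : ℂ | a < s.re ∧ s.re < b ∧ |s.im| < T} := by
  have hη : 0 < w.im := hw
  have hUo : IsOpen {s : ℂ | a < s.re ∧ s.re < b ∧ |s.im| < T} :=
    (isOpen_lt continuous_const Complex.continuous_re).inter
      ((isOpen_lt Complex.continuous_re continuous_const).inter
        (isOpen_lt (continuous_abs.comp Complex.continuous_im) continuous_const))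
  set S : ℝ := |a| + |b| + T with hS
  set I : ℝ := ∫ v : ℝ, (1 + v ^ 2) ^ (-(3 + 2 * a) / 2) with hI
  have hI0 : 0 ≤ I := integral_nonneg fun v ↦ Real.rpow_nonneg (by positivity) _
  set K : ℝ := 160 * (1 + S) ^ 2 * Real.exp (2 * π * T) * I with hK
  have hK0 : 0 ≤ K := by positivity
  have hsum : Summable fun j : ℕ ↦
      K * (w.im ^ (-2 - 2 * a) + w.im ^ (-2 - 2 * b)) * (((2 : ℝ) ^ (j + 1)) ^ 2)⁻¹ :=
    hasSum_inv_four_pow_succ.summable.mul_left _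
  refine differentiableOn_tsum_of_summable_norm hsum (fun j ↦ ?_) hUo (fun j s hs ↦ ?_)
  · intro s hs
    exact (differentiableAt_scaled_rowCont_altWeight hw
      (by simp only [Set.mem_setOf_eq] at hs; linarith [hs.1]) j).differentiableWithinAt
  · obtain ⟨hsa, hsb, hsT⟩ := hs
    have hs1 : -1 < s.re := by linarith
    refine (norm_scaled_rowCont_altWeight_le hw hs1 j).trans ?_
    have hsn : ‖s‖ ≤ S := by
      calc ‖s‖ ≤ |s.re| + |s.im| := Complex.norm_le_abs_re_add_abs_im s
        _ ≤ (|a| + |b|) + T := by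
            refine add_le_add ?_ hsT.le
            rcases le_or_gt 0 s.re with h | h
            · rw [abs_of_nonneg h]; linarith [le_abs_self b, abs_nonneg a]
            · rw [abs_of_neg h]; linarith [neg_le_abs a, abs_nonneg b]
        _ = S := by rw [hS]
    have hexp : Real.exp (2 * π * |s.im|) ≤ Real.exp (2 * π * T) :=
      Real.exp_le_exp.mpr (by nlinarith [Real.pi_pos, hsT.le])
    have hIs : ∫ v : ℝ, (1 + v ^ 2) ^ (-(3 + 2 * s.re) / 2) ≤ I :=
      integral_one_add_sq_rpow_antitone (by linarith) (by linarith)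
    have hIs0 : 0 ≤ ∫ v : ℝ, (1 + v ^ 2) ^ (-(3 + 2 * s.re) / 2) :=
      integral_nonneg fun v ↦ Real.rpow_nonneg (by positivity) _
    have hpow := rpow_neg_two_sub_le hη hsa hsb
    have h4 : 0 ≤ (((2 : ℝ) ^ (j + 1)) ^ 2)⁻¹ := by positivity
    calc 160 * (1 + ‖s‖) ^ 2 * Real.exp (2 * π * |s.im|) *
          (∫ v : ℝ, (1 + v ^ 2) ^ (-(3 + 2 * s.re) / 2)) * w.im ^ (-2 - 2 * s.re) *
            (((2 : ℝ) ^ (j + 1)) ^ 2)⁻¹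
        ≤ 160 * (1 + S) ^ 2 * Real.exp (2 * π * T) * I *
            (w.im ^ (-2 - 2 * a) + w.im ^ (-2 - 2 * b)) * (((2 : ℝ) ^ (j + 1)) ^ 2)⁻¹ := by
          refine mul_le_mul_of_nonneg_right ?_ h4
          refine mul_le_mul ?_ hpow (Real.rpow_nonneg hη.le _) (by positivity)
          refine mul_le_mul ?_ hIs hIs0 (by positivity)
          refine mul_le_mul ?_ hexp (by positivity) (by positivity)
          nlinarith [norm_nonneg s, hsn]
      _ = K * (w.im ^ (-2 - 2 * a) + w.im ^ (-2 - 2 * b)) * (((2 : ℝ) ^ (j + 1)) ^ 2)⁻¹ := by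
          rw [hK]

/-- **The series is holomorphic on `Re s > -1`.** [folklore] -/
theorem differentiableOn_tsum_scaled_rowCont :
    DifferentiableOn ℂ (fun s : ℂ ↦ ∑' j : ℕ, ((2 ^ (j + 1) : ℕ) : ℂ) ^ (2 * s) *
      rowCont 2 altWeight (((2 ^ (j + 1) : ℕ) : ℂ) * w) s) {s : ℂ | -1 < s.re} := by
  intro s₀ hs₀
  simp only [Set.mem_setOf_eq] at hs₀
  set a : ℝ := (-1 + s₀.re) / 2 with ha
  set b : ℝ := s₀.re + 1 with hb
  set T : ℝ := |s₀.im| + 1 with hT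
  have ha' : -1 < a := by rw [ha]; linarith
  have hT' : 0 < T := by rw [hT]; positivity
  have hmem : s₀ ∈ {s : ℂ | a < s.re ∧ s.re < b ∧ |s.im| < T} :=
    ⟨by rw [ha]; linarith, by rw [hb]; linarith, by rw [hT]; linarith⟩
  have hUo : IsOpen {s : ℂ | a < s.re ∧ s.re < b ∧ |s.im| < T} :=
    (isOpen_lt continuous_const Complex.continuous_re).inter
      ((isOpen_lt Complex.continuous_re continuous_const).inter
        (isOpen_lt (continuous_abs.comp Complex.continuous_im) continuous_const))
  exact ((differentiableOn_tsum_scaled_rowCont_box hw (b := b) ha' hT').differentiableAt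
    (hUo.mem_nhds hmem)).differentiableWithinAt

/-- **`s ↦ R̃₀(w, s)` is holomorphic on `Re s > -1/2`.** [folklore] -/
theorem differentiableOn_fullRowCont :
    DifferentiableOn ℂ (fullRowCont w) {s : ℂ | -1 / 2 < s.re} := by
  have hη0 : ((w.im : ℝ) : ℂ) ≠ 0 := by exact_mod_cast hw.ne'
  intro s hs
  simp only [Set.mem_setOf_eq] at hs
  have h1 : DifferentiableAt ℂ (fun s : ℂ ↦ -I * constIntegral s * ((w.im : ℝ) : ℂ) ^ (-2 * s)) s :=
    (((differentiableAt_const _).mul (differentiableAt_constIntegral hs)).mul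
      ((differentiableAt_id.const_mul (-2 : ℂ)).const_cpow (Or.inl hη0)))
  have h2 : DifferentiableAt ℂ (fun s : ℂ ↦ ∑' j : ℕ, ((2 ^ (j + 1) : ℕ) : ℂ) ^ (2 * s) *
      rowCont 2 altWeight (((2 ^ (j + 1) : ℕ) : ℂ) * w) s) s :=
    (differentiableOn_tsum_scaled_rowCont hw).differentiableAt
      ((isOpen_lt continuous_const Complex.continuous_re).mem_nhds (by
        simp only [Set.mem_setOf_eq]; linarith))
  exact (h1.add h2).differentiableWithinAt

/-- `s ↦ R̃₀(w, s)` is complex differentiable at every `s` with `Re s > -1/2`. [folklore] -/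
theorem differentiableAt_fullRowCont {s : ℂ} (hs : -1 / 2 < s.re) :
    DifferentiableAt ℂ (fullRowCont w) s :=
  (differentiableOn_fullRowCont hw).differentiableAt
    ((isOpen_lt continuous_const Complex.continuous_re).mem_nhds hs)

/-! ### The polynomial bound -/

/-- **`‖R̃₀(w, s)‖ ≤ I(2+2σ) (Im w)^{-2σ} + (160/3)(1+‖s‖)² e^{2π|Im s|} I(3+2σ) (Im w)^{-2-2σ}`**
for `Re s > -1/2`. [folklore] -/
theorem norm_fullRowCont_le {s : ℂ} (hs : -1 / 2 < s.re) :
    ‖fullRowCont w s‖ ≤ (∫ u : ℝ, (1 + u ^ 2) ^ (-1 - s.re)) * w.im ^ (-2 * s.re) +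
      160 * (1 + ‖s‖) ^ 2 * Real.exp (2 * π * |s.im|) *
        (∫ v : ℝ, (1 + v ^ 2) ^ (-(3 + 2 * s.re) / 2)) * w.im ^ (-2 - 2 * s.re) * (1 / 3) := by
  have hη : 0 < w.im := hw
  unfold fullRowCont
  refine (norm_add_le _ _).trans (add_le_add ?_
    (norm_tsum_scaled_rowCont_altWeight_le hw (by linarith)))
  rw [norm_mul, norm_mul, norm_neg, Complex.norm_I, one_mul,
    Complex.norm_cpow_eq_rpow_re_of_pos hη]
  simp only [Complex.mul_re, Complex.neg_re, Complex.re_ofNat, Complex.im_ofNat,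
    zero_mul, sub_zero, neg_mul]
  exact mul_le_mul_of_nonneg_right (norm_constIntegral_le s) (Real.rpow_nonneg hη.le _)

end Series

end Literature.NumberTheory.EllipticCurves.ModularForms
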